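import Summits.CriticalPhenomena.CardyFormulaZ2.Theorems.CardyIKTransportIKMixedBoxCrossingDefs

/-!
# Vocabulary v2 of the line `paired-mirror-exploration` for the crux `IKMixedBoxCrossing` (stmt-CriticalPhenomena-5911)

Second definitions-only support file of the lead's registered skeleton (reshape v2): the MIRROR structure of the
gauge in the cell row `0` (`reflCell`, `reflFace`, the bit maps `Θ₀`, `Φ₀` and their rest parts `θrest`, the
coordinate split `upR`/`loR` of the non-`A` factors `Rest` with law `νrest`), the observable readings `reflObs`,
`complObs`, the wave-2 stub STATEMENTS `Mirror` (reflection positivity in a cell row, every `S`), `FiniteEnergy`,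
`ConditioningStep` (Smirnov's conditioning step for the isotropic gauge, paired symmetrisation), `PolyDoubling`
(the FKG-free polynomial doubling), `IsoDoubling` (OPEN: the junction) and `PatternLayerV2` (OPEN: the `∀S` layer),
and the v2 glue/composition `IKMixedBoxCrossing_of_stubsV2` (sorry-free) concluding both route decls by name.
Nothing is asserted: every `def … : Prop` is a statement the LINE POSITS, not a literature fact.  See the crux
`NOTES.md` (lead, cycle 1) for the mathematics (E1–E7, J1–J5).
-/

noncomputable section

namespace Summit.CriticalPhenomena.CardyFormulaZ2.Cruxes.IKMixedBoxCrossing.PairedMirrorExploration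

open scoped Classical
open MeasureTheory
open Literature.Probability.Percolation Literature.Probability.LatticeModels
open Summit.CriticalPhenomena.CardyFormulaZ2.Theorems.IKLinearTransport.PinnedDiagramExchange
  (Ω μIK parSet blackSet antiSet Obs obs νmix blackEdges lrCross tbCross)

/-! ## §8 Wave-2 vocabulary (reshape v2): the mirror structure at the axis row `0`, finite energy,
Smirnov's conditioning step at `S = univ`, the isotropic doubling -/

section MirrorVocabulary

open Summit.CriticalPhenomena.CardyFormulaZ2.Theorems.IKLinearTransport.PinnedDiagramExchange (determinedOn)

/-- Reflection of CELLS in the axis row `0`: `(x, y) ↦ (x, -y)`. -/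
def reflCell : Site 2 ≃ Site 2 where
  toFun v := ![v 0, -(v 1)]
  invFun v := ![v 0, -(v 1)]
  left_inv v := by ext i; fin_cases i <;> simp
  right_inv v := by ext i; fin_cases i <;> simp

/-- Reflection of FACES in the axis row `0` (faces are labelled by their lower-left cell; the face `(x, y)`
spans the rows `y, y+1`, its mirror image spans `-y-1, -y`): `(x, y) ↦ (x, -1 - y)`. -/
def reflFace : Site 2 ≃ Site 2 where
  toFun f := ![f 0, -1 - f 1]
  invFun f := ![f 0, -1 - f 1]
  left_inv f := by ext i; fin_cases i <;> simp
  right_inv f := by ext i; fin_cases i <;> simp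

/-- THE BIT-LEVEL MIRROR `Θ₀ : Ω → Ω` in the axis row `0`: column signs kept, row signs reflected
(`y ↦ -y`), both plaquette fields reflected along `reflFace`, coins reflected and COMPLEMENTED (a reflection
swaps main and anti diagonals).  For every pattern `S` it reflects the colours (`blackSet S (Θ₀ ω) =
reflCell ⁻¹' blackSet S ω`: the rectangle from `0` to `(x, -y)` is the `reflFace`-image of the one to
`(x, y)`); at `S = univ` it also reflects-and-flips the diagonals, i.e. `obs univ ∘ Θ₀ = reflObs ∘ obs univ`. -/
def Θ₀ (ω : Ω) : Ω :=
  (ω.1, SiteConfig.relabel (Equiv.neg ℤ) ω.2.1, SiteConfig.relabel reflFace ω.2.2.1,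
    SiteConfig.relabel reflFace ω.2.2.2.1, (SiteConfig.relabel reflFace ω.2.2.2.2)ᶜ)

/-- The mirror composed with the colour flip `B ↦ Bᶜ` (complement of the row signs): at `S = univ`,
`obs univ ∘ Φ₀ = reflObs ∘ (colour complement) ∘ obs univ`.  It fixes the column signs `A`, like `Θ₀`. -/
def Φ₀ (ω : Ω) : Ω := Θ₀ (ω.1, ω.2.1ᶜ, ω.2.2)

/-- The mirror on observables (isotropic reading): reflected black cells, reflected-and-flipped
anti-diagonal flags. -/
def reflObs (x : Obs) : Obs := (reflCell ⁻¹' x.1, (reflFace ⁻¹' x.2)ᶜ)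

/-- Colour complement on observables (same diagonals). -/
def complObs (x : Obs) : Obs := (x.1ᶜ, x.2)


/-- The last four components of `Θ₀`, as a measurable equivalence of the four non-`A` factors of the gauge
(row signs reflected, plaquettes reflected, coins reflected and complemented). -/
def θrest : Set ℤ × (Set (Site 2) × (Set (Site 2) × Set (Site 2))) ≃ᵐ
    Set ℤ × (Set (Site 2) × (Set (Site 2) × Set (Site 2))) :=
  MeasurableEquiv.prodCongr (SiteConfig.relabel (Equiv.neg ℤ))
    (MeasurableEquiv.prodCongr (SiteConfig.relabel reflFace)
      (MeasurableEquiv.prodCongr (SiteConfig.relabel reflFace)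
        ((SiteConfig.relabel reflFace).trans (SiteConfig.complEquiv (Site 2)))))

/-- The reindexing `(x, y) ↦ (x, -1-y)` of plaquette coordinates (row reflection of faces). -/
def rowFlip : ℤ × ℤ ≃ ℤ × ℤ where
  toFun f := (f.1, -1 - f.2)
  invFun f := (f.1, -1 - f.2)
  left_inv f := Prod.ext rfl (by dsimp only; omega)
  right_inv f := Prod.ext rfl (by dsimp only; omega)

/-- The four non-`A` factors of the gauge (row signs, biased plaquettes, fair plaquettes, coins). -/
abbrev Rest : Type := Set ℤ × (Set (Site 2) × (Set (Site 2) × Set (Site 2)))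

/-- Their joint law (so that `μIK = (sitePercolation ℤ half).prod νrest` definitionally). -/
def νrest : Measure Rest :=
  (sitePercolation ℤ half).prod
    ((sitePercolation (Site 2) (Set.projIcc (0:ℝ) 1 zero_le_one (2 * Real.sqrt 3 - 3))).prod
      ((sitePercolation (Site 2) half).prod (sitePercolation (Site 2) half)))

/-- Upper row signs (`y ≥ 1`). -/
def UB : Set ℤ := {y | 1 ≤ y}
/-- Lower row signs (`y ≤ -1`). -/
def LB : Set ℤ := {y | y ≤ -1}
/-- Upper plaquettes (faces with `0 ≤ f 1`). -/
def UF : Set (Site 2) := {f | 0 ≤ f 1}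
/-- Lower plaquettes (faces with `f 1 ≤ -1`). -/
def LF : Set (Site 2) := {f | f 1 ≤ -1}
/-- Upper coins (faces with `1 ≤ f 1`). -/
def UC : Set (Site 2) := {f | 1 ≤ f 1}
/-- Lower coins (faces with `f 1 ≤ -2`). -/
def LC : Set (Site 2) := {f | f 1 ≤ -2}

/-- Restriction of the rest to its UPPER coordinates. -/
def upR (r : Rest) : Rest := (r.1 ∩ UB, (r.2.1 ∩ UF, (r.2.2.1 ∩ UF, r.2.2.2 ∩ UC)))

/-- Restriction of the rest to its LOWER coordinates. -/
def loR (r : Rest) : Rest := (r.1 ∩ LB, (r.2.1 ∩ LF, (r.2.2.1 ∩ LF, r.2.2.2 ∩ LC)))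

/-- The rest part of `Φ₀`: complement the row signs, then mirror. -/
def φrest (r : Rest) : Rest := θrest (r.1ᶜ, r.2)

/-- `νrest` is a probability measure. -/
instance instIsProbabilityMeasure_νrest : IsProbabilityMeasure νrest := by unfold νrest; infer_instance

/-- Events of observables determined by FINITELY many cells/faces of the OPEN upper half-plane (cells in rows
`≥ 1`, faces with lower-left cell in rows `≥ 1`) — every box event of a box inside the upper half-plane is such. -/
def UpperDet (E : Set Obs) : Prop :=
  ∃ Λ : Finset (Site 2), (∀ v ∈ Λ, 1 ≤ v 1) ∧ E ∈ determinedOn (↑Λ : Set (Site 2))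

/-- STUB statement — THE MIRROR (reflection positivity of the gauge in a cell row, every `S`, and its
isotropic reading).  (a) `Θ₀` and `Φ₀` preserve `μIK`; (b) at `S = univ` they act on observables by `reflObs`
(resp. `reflObs ∘ complObs`); (c) MIRROR-GLUING INEQUALITIES: for every pattern `S` and every measurable
event `E` of observables determined by finitely many cells/faces of the open upper half-plane,
`μIK(obs S ⁻¹' E)² ≤ μIK(obs S ⁻¹' E ∩ Θ₀ ⁻¹' (obs S ⁻¹' E))` and the same with `Φ₀`.  Mechanism: re-anchored
at the axis row, the colours of rows `≥ 1` read `(A, B_{≥1}, faces with f 1 ≥ 0)` and those of rows `≤ -1`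
read `(A, B_{≤-1}, faces with f 1 ≤ -1)`; given the column signs `A` the two halves are independent and `Θ₀`,
`Φ₀` fix `A` and preserve the conditional law, so `μ(E ∩ Θ₀⁻¹E) = ∫ ν(E_A)² dμ_A ≥ (∫ ν(E_A))²`.  A statement
to be proved (registered stub), not asserted here. -/
def Mirror : Prop :=
  MeasurePreserving Θ₀ μIK μIK ∧ MeasurePreserving Φ₀ μIK μIK ∧
  (∀ ω, obs Set.univ (Θ₀ ω) = reflObs (obs Set.univ ω)) ∧
  (∀ ω, obs Set.univ (Φ₀ ω) = reflObs (complObs (obs Set.univ ω))) ∧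
  (∀ (S : Set ℤ) (E : Set Obs), MeasurableSet E → UpperDet E →
    μIK.real (obs S ⁻¹' E) ^ 2 ≤ μIK.real (obs S ⁻¹' E ∩ Θ₀ ⁻¹' (obs S ⁻¹' E)) ∧
    μIK.real (obs S ⁻¹' E) ^ 2 ≤ μIK.real (obs S ⁻¹' E ∩ Φ₀ ⁻¹' (obs S ⁻¹' E)))

/-- STUB statement — FINITE ENERGY (every `S`): toggling the four plaquette bits around a cell flips exactly
that cell and nothing else (all quadrants) at density cost `≤ (2/√3)⁴ = 16/9`, so for every measurable event
`E` of observables not reading the cell `v`, `(9/25) μIK(obs S ⁻¹' E) ≤ μIK(obs S ⁻¹' E ∩ {v black})`.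
A statement to be proved (registered stub), not asserted here. -/
def FiniteEnergy : Prop :=
  ∀ (S : Set ℤ) (v : Site 2) (E : Set Obs), MeasurableSet E → E ∈ determinedOn {u : Site 2 | u ≠ v} →
    (9 / 25 : ℝ) * μIK.real (obs S ⁻¹' E) ≤ μIK.real (obs S ⁻¹' E ∩ {ω | v ∈ blackSet S ω})

/-- The doubled band `R' = [0, w) × [-h, h]` (height `2h+1`), its top row, its bottom row and the lower half
`RL` of its right column (fattened by the rows `0, 1`, see `bandRL`). -/
def band (w h : ℕ) : Set (Site 2) := {v | 0 ≤ v 0 ∧ v 0 < w ∧ -(h : ℤ) ≤ v 1 ∧ v 1 ≤ h}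

/-- Top row of the band. -/
def bandTop (w h : ℕ) : Set (Site 2) := {v | v 1 = h ∧ 0 ≤ v 0 ∧ v 0 < w}

/-- Bottom row of the band. -/
def bandBot (w h : ℕ) : Set (Site 2) := {v | v 1 = -(h : ℤ) ∧ 0 ≤ v 0 ∧ v 0 < w}

/-- FAT lower half of the right column of the band (rows `-h … 1`): the cells of the band adjacent, in SOME triangulation, to the
right padding column at rows `≤ 0` (the axis cell `(w, 0)` of the padding is fixed by the mirror, so both it and its diagonal
neighbours `(w-1, ±1)` must be allowed as arrival cells — the brick-parity accident that spares the tree's `SmirnovRSW` this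
case does not happen on the cell lattice; the junction absorbs the overlap of the two fat halves at rows `-1, 0, 1` by finite
energy at `(w-1, 0)`). -/
def bandRL (w h : ℕ) : Set (Site 2) := {v | v 0 = (w : ℤ) - 1 ∧ -(h : ℤ) ≤ v 1 ∧ v 1 ≤ 1}

/-- SMIRNOV'S DIAGONAL EVENT `A'` (vertical doubling at the axis row `0`): a black path inside the band from
its top row to (the fat lower half of its right column ∪ its bottom row). Its mirror image `Θ₀⁻¹ A'` joins the
bottom row to (the fat upper half of the right column ∪ the top row); `A' ∩ Θ₀⁻¹A' ∩ {(w-1,0) black}` forces a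
bottom-to-top crossing of the band (two transversal paths in a triangulated quad meet, or end within the rows
`-1…1` of the right column and are joined through `(w-1,0)`). -/
def diagEvent (w h : ℕ) : Set Obs :=
  {x | blackEdges x ∈ openCrossing (band w h) (bandTop w h) (bandRL w h ∪ bandBot w h)}

/-- STUB statement — SMIRNOV'S CONDITIONING STEP for the isotropic gauge, FKG-free (paired symmetrisation,
§2): for `w ≥ 2`, `h ≥ 1`, `P(A') ≥ ½ · P(black TB crossing of R = [0,w)×[1,h] ∧ white TB crossing of its
mirror image)`, the second event being `Φ₀ ⁻¹` of the first (`Φ₀` = mirror ∘ colour flip).  Port of the tree's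
`SmirnovRSW.half_brickHProb_le_real_A'ev` (Grimmett 2018 Lemma 5.20, conditioning step) to the cell
triangulation with coins: explore the white cluster `L` of the left column of `R` inside `R`, pair it with the
black cluster of the left column of the mirror box, pad, apply the cell Hex lemma (`cellCrossing_duality_holds`)
in a bounding rectangle, and sum `paired_symmetrisation` over admissible pairs — no independence, no Harris.
A statement to be proved (registered stub), not asserted here. -/
def ConditioningStep : Prop :=
  ∀ w h : ℕ, 2 ≤ w → 1 ≤ h →
    (1 / 2 : ℝ) * μIK.real (obs Set.univ ⁻¹' tbCross 0 1 w h ∩ Φ₀ ⁻¹' (obs Set.univ ⁻¹' tbCross 0 1 w h)) ≤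
      μIK.real (obs Set.univ ⁻¹' diagEvent w h)

/-- STUB statement — POLYNOMIAL DOUBLING (isotropic gauge; the first rigorous FKG-free doubling here):
`pTB(w × (2h+1)) ≥ (9/25) · pTB(w × h)² / w²` — mirror-gluing at one axis cell made black by finite energy,
union bound over the `w` cells.  From `Mirror`, `FiniteEnergy` and pattern locality.  A statement to be
proved (registered stub), not asserted here. -/
def PolyDoubling : Prop :=
  Mirror → FiniteEnergy → PatternLocality →
    ∀ w h : ℕ, 2 ≤ w → 1 ≤ h →
      (9 / 25 : ℝ) * pTB Set.univ 0 0 w h ^ 2 / (w : ℝ) ^ 2 ≤ pTB Set.univ 0 0 w (2 * h + 1)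

/-- STUB statement — ISOTROPIC DOUBLING (OPEN: the junction (α)): threshold-form vertical doubling for the
isotropic gauge at the origin.  Intended proof: `ConditioningStep` (+ `Mirror` for the admissible pairs:
`P(adm) ≥ v²` exactly) gives `P(A') ≥ ½ v²`; the missing estimate is `P(A' ∩ Θ₀⁻¹A') ≥ g(P(A'))` — see the
crux `NOTES.md` (J1–J5: it is a boundary-condition robustness / second-moment statement for axis arrivals,
not reachable by symmetry alone).  A statement to be proved (registered stub), not asserted here. -/
def IsoDoubling : Prop :=
  ∀ c₀ : ℝ, 0 < c₀ → ∃ c₁ : ℝ, 0 < c₁ ∧ ∀ w h : ℕ, 2 ≤ w → 1 ≤ h →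
    c₀ ≤ pTB Set.univ 0 0 w h → c₁ ≤ pTB Set.univ 0 0 w (2 * h + 1)

/-- STUB statement — THE `∀S` LAYER (OPEN), v2: from RSW of the two pure media (isotropic: iterated isotropic
doubling; honeycomb: the tree's `tri_rsw_half_holds`), the named form of the crux for every column pattern
(squares, tall and wide clauses; mechanism: the sheared-mirror doubling `Ψ_S` for the tall clause — exact
symmetry and reflection positivity for every `S`, same junction — and an FKG-free gluing for the wide clause).
A statement to be proved (registered stub), not asserted here. -/
def PatternLayerV2 : Prop :=
  IsotropicRSW → HoneycombRSW →
    ∃ c : ℝ, 0 < c ∧ ∀ S : Set ℤ, ∀ n : ℕ, 1 ≤ n → ∀ a b : ℤ, c ≤ pLR S a b (2 * n) n ∧ c ≤ pTB S a b n (2 * n)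

end MirrorVocabulary

/-! ## §9 Composition v2 (sorry-free): isotropic doubling at the origin suffices for `IsotropicRSW` -/

/-- Iterating the isotropic doubling at the origin (v2 of `pTB_dblWidth_univ`). -/
theorem pTB_dblWidth_univV2 (hL : PatternLocality) (hD : Duality) (hQ : QuarterTurn) (hE : IsoDoubling) :
    ∀ k : ℕ, ∃ c : ℝ, 0 < c ∧ ∀ h : ℕ, 2 ≤ h → c ≤ pTB Set.univ 0 0 h (dblWidth k h) := by
  intro k
  induction k with
  | zero =>
    refine ⟨1 / 2, by norm_num, fun h hh => ?_⟩
    rw [dblWidth_zero, pTB_square_univ hL hD hQ hh]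
  | succ k ih =>
    obtain ⟨c, hc, hk⟩ := ih
    obtain ⟨c', hc', hstep⟩ := hE c hc
    refine ⟨c', hc', fun h hh => ?_⟩
    rw [dblWidth_succ]
    have hw : 1 ≤ dblWidth k h := by
      have h1 := succ_mul_le_dblWidth k h
      have h2 : h ≤ (k + 1) * h := Nat.le_mul_of_pos_left h (Nat.succ_pos k)
      omega
    exact hstep h (dblWidth k h) hh hw (hk h hh)

/-- Stubs 1–4 and the isotropic doubling give `IsotropicRSW` (v2 of `isotropicRSW_of`). -/
theorem isotropicRSW_ofV2 (hL : PatternLocality) (hD : Duality) (hQ : QuarterTurn) (hM : Monotone')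
    (hE : IsoDoubling) : IsotropicRSW := by
  intro k
  obtain ⟨c, hc, hk⟩ := pTB_dblWidth_univV2 hL hD hQ hE k
  have key : ∀ w h : ℕ, 2 ≤ w → w ≤ h → h ≤ k * w → c ≤ pTB Set.univ 0 0 w h := by
    intro w h hw hwh hhk
    have hle : h ≤ dblWidth k w := by
      have h1 := succ_mul_le_dblWidth k w
      have h2 : k * w ≤ (k + 1) * w := Nat.mul_le_mul_right w (Nat.le_succ k)
      omega
    calc c ≤ pTB Set.univ 0 0 w (dblWidth k w) := hk w hw
      _ ≤ pTB Set.univ 0 0 w h := hM.2 Set.univ 0 0 w h (dblWidth k w) (by omega) hle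
  refine ⟨c, hc, ?_, ?_⟩
  · intro S a b w h hh hhw hwk hiso
    rw [(iso_recentre hL hiso b h).1, ← pTB_univ_eq_pLR_univ hL hQ h w]
    exact key h w hh hhw hwk
  · intro S a b w h hw hwh hhk hiso
    rw [(iso_recentre hL hiso b h).2]
    exact key w h hw hwh hhk

/-- **COMPOSITION v2** (kernel-checked, no `sorry`): stubs 1–5, the isotropic doubling and the `∀S` layer v2
imply the crux (home decl) by name. -/
theorem IKMixedBoxCrossing_of_stubsV2 :
    PatternLocality → Duality → QuarterTurn → Monotone' → (PatternLocality → HoneycombRSW) →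
      IsoDoubling → PatternLayerV2 →
        Summit.CriticalPhenomena.CardyFormulaZ2.Theses.CardyDiluteOrbit.IKMixedBoxCrossing :=
  fun h1 h2 h3 h4 h5 h6 h7 => iff_cbox.2 (h7 (isotropicRSW_ofV2 h1 h2 h3 h4 h6) (h5 h1))

/-- The same v2 composition for the payload-route copy. -/
theorem IKMixedBoxCrossing_transport_of_stubsV2 (h1 : PatternLocality) (h2 : Duality) (h3 : QuarterTurn)
    (h4 : Monotone') (h5 : PatternLocality → HoneycombRSW) (h6 : IsoDoubling) (h7 : PatternLayerV2) :
    Summit.CriticalPhenomena.CardyFormulaZ2.Theses.CardyIKTransport.IKMixedBoxCrossing :=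
  iff_cbox_transport.2 (h7 (isotropicRSW_ofV2 h1 h2 h3 h4 h6) (h5 h1))

end Summit.CriticalPhenomena.CardyFormulaZ2.Cruxes.IKMixedBoxCrossing.PairedMirrorExploration

end
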